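import Summits.AtomisticToContinuum.HydrodynamicLimit.Theorems.CollisionIsometryCLTAdaptedWeightCLTTLSourceContractionConverse
import Literature.Analysis.FluidPDE.HardSphereCollisionRecord

/-!
# Vocabulary of the line `Sketch` (contact-balance composition) for the crux `AdaptedWeightCLT`
(stmt-AtomisticToContinuum-14868, rev-12 TIME-LOCAL form; route `CollisionIsometryCLT`, sub-problem
`HydrodynamicLimit`)

Definitions-only support file (`--supports stmt-AtomisticToContinuum-14868`) of the line lead
`prover-line-stmt-AtomisticToContinuum-14868-c1-0` (skeleton `Cruxes/AdaptedWeightCLT/Lines/Sketch.lean`, card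
`Cruxes/AdaptedWeightCLT/Ideas/contact-balance-knudsen-margin.md`). It makes the line's vocabulary IMPORTABLE so
that each registered stub (`stub_pointwise`, `stub_lipschitz`, `stub_freeStretch`, `stub_pathwiseBudget`,
`stub_timeZero`, `stub_tailsVmax`, `stub_coercivity`) lands in its own sorry-free Theorems file with the registered
signature verbatim. Nothing is asserted here: every `def … : Prop` is a predicate taken as a HYPOTHESIS by the stub
that consumes it and PROVED by the stub that produces it (`PointwiseFreeFlight` by `stub_pointwise`,
`FreeFlightLipschitz` by `stub_lipschitz`, `FreeStretchBound` by `stub_freeStretch`).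

THE MECHANISM. Do the bookkeeping EULERIAN, along the flow, for the crux's own functional: the block kinetic
anisotropy `anis(w) = ∫ₓ Σ_{jk} D_{jk}(w,x)² + |q(w,x)|² dx` of a configuration `w` (`anisC`; the crux integrand is
`DefectSq` by the landed dictionary `Reduction.cruxIntegrand_eq`, and `DefectSq σ N Φ φ s z x = defectC N φ (Φ.flow s z) x`
by `rfl`, `defectSq_eq_defectC`). Along a good orbit `s ↦ Φ_s z`, `anis(Φ_s z)` moves by free-flight streaming
between collisions and jumps at the finitely many collision times; the total collisional anisotropy DROP on
`(0, t]`, `prodColl = Σ_{collisions} (anis(pre) − anis(post))` (the PRODUCTION, pre-collisional configurations read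
off through the elastic involution `collidePair`), telescopes into `anis(Φ_0 z) − anis(Φ_t z) + (free-flight
increments)`, and the increments are controlled by the `L²ₓ`-Lipschitz estimate `FreeFlightLipschitz` of the block
fields `(D, q)` along free flight, constant `K (N+1)^γ (1 + v_max)⁴` (pointwise form `PointwiseFreeFlight`, one
free stretch `FreeStretchBound`). With the time-zero statics of the local Gibbs law and H2 this is the production
BUDGET `prodColl ≤ B (N+1)^{γ'} (1 + √X)`, `X = Xint = ∫₀ᵗ anis` the crux functional; the residue of the line is
COERCIVITY of `prodColl` at a power rate `(N+1)^β`, `β > γ`; `κ X ≤ A + B √X ⇒ X ≤ 2A/κ + (B/κ)²` closes `ConclOn`.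

Objects: `wgtC, ubarC, blkC, defectC` (the flow-side `wgt, ubar, blkFlow, DefectSq` of
`…Theorems.ContactSourceDuhamel` with `Φ_s z` replaced by a configuration `w`), `anisC`, `vmax`, `l2dist`,
`blockCount`, `prodColl` (over `HardSphereFlow.collisionPairSum`), `Xint`, `vmaxInt`; predicates
`FreeFlightLipschitz`, `PointwiseFreeFlight`, `FreeStretchBound`; anchors `defectSq_eq_defectC`, `xint_eq` (`rfl`).
-/

namespace Summit.AtomisticToContinuum.HydrodynamicLimit.Theorems.ContactBalance

open scoped BigOperators Topology Classical MeasureTheory ENNReal InnerProductSpace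
open Filter Set MeasureTheory
open Literature.Analysis.FluidPDE
open Summit.AtomisticToContinuum.HydrodynamicLimit.Theorems.ContactSourceDuhamel
open Summit.AtomisticToContinuum.HydrodynamicLimit.Theorems.ContactSourceDuhamel.TimeLocal
open Literature.MathematicalPhysics.KineticTheory (hsDiameter localGibbsLaw empiricalDensityField
  empiricalMomentumField)

noncomputable section

/-! ## Vocabulary (configuration-level block functionals, production, the Lipschitz statement) -/

/-- Block weights of a CONFIGURATION `w` at `x`: `w_i = φ_N(x_i − x)` (the flow-side `wgt` with `Φ_s z`
replaced by `w`). -/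
def wgtC (N : ℕ) (φ : ℕ → T3 → ℝ) (w : Cfg N) (x : T3) : Fin (N + 1) → ℝ :=
  fun i => φ N ((w i).1 - x)

/-- Block velocity `ū = m̄/ρ̄` of a configuration at `x` (the flow-side `ubar` with `Φ_s z` replaced by `w`;
junk `0⁻¹ = 0` where the block is empty, as in the crux). -/
def ubarC (N : ℕ) (φ : ℕ → T3 → ℝ) (w : Cfg N) (x : T3) : V3 :=
  (empiricalDensityField w (fun y => φ N (y - x)))⁻¹ • empiricalMomentumField w (fun y => φ N (y - x))

/-- Rank-`r` block moment of a configuration at `x` tested against `C` (the flow-side `blkFlow` with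
`Φ_s z` replaced by `w`). -/
def blkC (r N : ℕ) (φ : ℕ → T3 → ℝ) (w : Cfg N) (x : T3) (C : Tens r) : ℝ :=
  ((N + 1 : ℕ) : ℝ)⁻¹ * ∑ i : Fin (N + 1), wgtC N φ w x i * pairT C (tpow r ((w i).2 - ubarC N φ w x))

/-- `Σ_{jk} D_{jk}² + |q|²` of a configuration at `x` (the flow-side `DefectSq` with `Φ_s z` replaced by
`w`; `defectSq_eq_defectC`). -/
def defectC (N : ℕ) (φ : ℕ → T3 → ℝ) (w : Cfg N) (x : T3) : ℝ :=
  (∑ j : Fin 3, ∑ k : Fin 3, blkC 2 N φ w x (C2 j k) ^ 2) + ∑ a : Fin 3, blkC 3 N φ w x (C3 a) ^ 2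

/-- The BLOCK KINETIC ANISOTROPY of a configuration: `anis(w) = ∫ₓ Σ D² + |q|² dx` (Bochner integral over
`𝕋³`; the integrand is continuous, so this is an honest integral). -/
def anisC (N : ℕ) (φ : ℕ → T3 → ℝ) (w : Cfg N) : ℝ :=
  ∫ x, defectC N φ w x

/-- The maximal speed `v_max(w) = max_i |v_i|` of a configuration. -/
def vmax (N : ℕ) (w : Cfg N) : ℝ :=
  Finset.univ.sup' Finset.univ_nonempty fun i : Fin (N + 1) => ‖(w i).2‖

/-- The `L²ₓ` distance of the block fields `(D, q)` of two configurations: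
`(∫ₓ Σ_{jk} (D_{jk}(w') − D_{jk}(w))² + |q(w') − q(w)|² dx)^{1/2}`. -/
def l2dist (N : ℕ) (φ : ℕ → T3 → ℝ) (w w' : Cfg N) : ℝ :=
  Real.sqrt (∫ x, ((∑ j : Fin 3, ∑ k : Fin 3, (blkC 2 N φ w' x (C2 j k) - blkC 2 N φ w x (C2 j k)) ^ 2) +
    ∑ a : Fin 3, (blkC 3 N φ w' x (C3 a) - blkC 3 N φ w x (C3 a)) ^ 2))

/-- The COLLISIONAL PRODUCTION on `(0, t]` along the orbit of `z`: the sum over the collisions of the flow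
(collision times in `(0, t]`, each binary collision counted once through its ordered contact pair `i < j`) of
the anisotropy DROP `anis(pre) − anis(post)`, the pre-collisional configuration being read off the
post-collisional one through the elastic involution `collidePair` (`= leftLim` on good orbits,
`IsHardSphereTrajectory.eq_collidePair_leftLim`, `collidePair_collidePair`). Meaningful on `Φ.good`. -/
def prodColl (σ : ℝ) (N : ℕ) (Φ : Flow σ N) (φ : ℕ → T3 → ℝ) (t : ℝ) (z : Cfg N) : ℝ :=
  Φ.collisionPairSum (Set.Ioc 0 t)
    (fun _ w i j => if i < j then
      anisC N φ (collidePair (Torus.geometry (Fin 3)) i j w) - anisC N φ w else 0) z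

/-- The crux functional on `[0, t]`: `X = ∫₀ᵗ ∫ₓ Σ D² + |q|²` (verbatim the integral of `ConclOn`'s event in
`DefectSq` form). -/
def Xint (σ : ℝ) (N : ℕ) (Φ : Flow σ N) (φ : ℕ → T3 → ℝ) (t : ℝ) (z : Cfg N) : ℝ :=
  ∫ s in Icc 0 t, ∫ x, DefectSq σ N Φ φ s z x

/-- The time-integrated eighth power of the maximal speed, `∫₀ᵗ (1 + v_max(Φ_s z))⁸ ds`. -/
def vmaxInt (σ : ℝ) (N : ℕ) (Φ : Flow σ N) (t : ℝ) (z : Cfg N) : ℝ :=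
  ∫ s in Icc 0 t, (1 + vmax N (Φ.flow s z)) ^ 8

/-- FREE-FLIGHT `L²ₓ`-LIPSCHITZ ESTIMATE of the block fields at reduced density `σ` for the kernel family
`φ` with exponent `γ`: there are `K` and `N₀` such that for `N ≥ N₀`, every configuration `w` of the
hard-sphere domain and every `r ≥ 0` with `freeFlight r w` again in the domain,
`‖(D,q)(freeFlight r w) − (D,q)(w)‖_{L²ₓ} ≤ K (N+1)^γ (1 + v_max(w))⁴ r`. -/
def FreeFlightLipschitz (γ : ℝ) (φ : ℕ → T3 → ℝ) (σ : ℝ) : Prop :=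
  ∃ K : ℝ, ∃ N₀ : ℕ, ∀ N : ℕ, N₀ ≤ N → ∀ (w : Cfg N) (r : ℝ), 0 ≤ r →
    w ∈ hardSphereDomain (Torus.geometry (Fin 3)) (N + 1) (hsDiameter σ N) →
    freeFlight (Torus.geometry (Fin 3)) r w ∈ hardSphereDomain (Torus.geometry (Fin 3)) (N + 1) (hsDiameter σ N) →
      l2dist N φ w (freeFlight (Torus.geometry (Fin 3)) r w) ≤
        K * ((N + 1 : ℕ) : ℝ) ^ γ * (1 + vmax N w) ^ 4 * r

/-- The number of particles of a configuration within minimal-image distance `R` of `x`. -/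
def blockCount (N : ℕ) (R : ℝ) (w : Cfg N) (x : T3) : ℕ :=
  (Finset.univ.filter fun i : Fin (N + 1) => Torus.euclidDist (w i).1 x < R).card

/-- POINTWISE FREE-FLIGHT INCREMENT BOUND for the kernel family `φ` with exponent `γ`: there is `A` such that
for every `N`, configuration `w`, `r ≥ 0` and `x`, every component of the block fields `D_{jk} = blkC 2 (C2 j k)`,
`q_a = blkC 3 (C3 a)` moves along the free flight `w ↦ freeFlight r w` by at most
`A (N+1)^{4γ} r (1 + v_max(w))⁴ (N+1)⁻¹ (n_w(x) + n_{w'}(x))`, `n_w(x)` = the number of particles of `w` within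
`(N+1)^{−γ}` of `x` (pure algebra: `|φ_N(x_i + r v_i − x) − φ_N(x_i − x)| ≤ ‖∇φ_N‖_∞ |v_i| r`, supported where
`x_i(0)` or `x_i(r)` is in the block; `ρ(ū' − ū) = (m' − m) − ū'(ρ' − ρ)`; `|ū| ≤ v_max`). -/
def PointwiseFreeFlight (γ : ℝ) (φ : ℕ → T3 → ℝ) : Prop :=
  ∃ A : ℝ, ∀ (N : ℕ) (w : Cfg N) (r : ℝ) (x : T3), 0 ≤ r →
    (∀ j k : Fin 3, |blkC 2 N φ (freeFlight (Torus.geometry (Fin 3)) r w) x (C2 j k) - blkC 2 N φ w x (C2 j k)| ≤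
      A * ((N + 1 : ℕ) : ℝ) ^ (4 * γ) * r * (1 + vmax N w) ^ 4 * ((N + 1 : ℕ) : ℝ)⁻¹ *
        (blockCount N (((N + 1 : ℕ) : ℝ) ^ (-γ)) w x +
          blockCount N (((N + 1 : ℕ) : ℝ) ^ (-γ)) (freeFlight (Torus.geometry (Fin 3)) r w) x)) ∧
    (∀ a : Fin 3, |blkC 3 N φ (freeFlight (Torus.geometry (Fin 3)) r w) x (C3 a) - blkC 3 N φ w x (C3 a)| ≤
      A * ((N + 1 : ℕ) : ℝ) ^ (4 * γ) * r * (1 + vmax N w) ^ 4 * ((N + 1 : ℕ) : ℝ)⁻¹ *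
        (blockCount N (((N + 1 : ℕ) : ℝ) ^ (-γ)) w x +
          blockCount N (((N + 1 : ℕ) : ℝ) ^ (-γ)) (freeFlight (Torus.geometry (Fin 3)) r w) x))

/-- FREE-STRETCH BOUND at reduced density `σ`: there are `K`, `N₀` such that for `N ≥ N₀`, every configuration
`w`, every `T ≥ 0` such that the whole free flight `freeFlight r w`, `r ∈ [0, T]`, stays in the hard-sphere
domain: `anis(freeFlight T w) − anis(w) ≤ K (N+1)^γ (1 + v_max(w))⁴ ∫₀ᵀ √anis(freeFlight r w) dr`
(`√anis` is Lipschitz along the flight by the `L²ₓ`-Lipschitz estimate and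
`|anis(w') − anis(w)| ≤ l2dist(w,w') (√anis(w) + √anis(w'))`; FTC for absolutely continuous functions). -/
def FreeStretchBound (γ : ℝ) (φ : ℕ → T3 → ℝ) (σ : ℝ) : Prop :=
  ∃ K : ℝ, ∃ N₀ : ℕ, ∀ N : ℕ, N₀ ≤ N → ∀ (w : Cfg N) (T : ℝ), 0 ≤ T →
    (∀ r ∈ Icc 0 T, freeFlight (Torus.geometry (Fin 3)) r w ∈
      hardSphereDomain (Torus.geometry (Fin 3)) (N + 1) (hsDiameter σ N)) →
      anisC N φ (freeFlight (Torus.geometry (Fin 3)) T w) - anisC N φ w ≤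
        K * ((N + 1 : ℕ) : ℝ) ^ γ * (1 + vmax N w) ^ 4 *
          ∫ r in Icc 0 T, Real.sqrt (anisC N φ (freeFlight (Torus.geometry (Fin 3)) r w))

/-- The flow-side crux integrand IS the configuration-level one at `Φ_s z` (definitional). -/
theorem defectSq_eq_defectC : ∀ (σ : ℝ) (N : ℕ) (Φ : Flow σ N) (φ : ℕ → T3 → ℝ) (s : ℝ) (z : Cfg N) (x : T3),
    DefectSq σ N Φ φ s z x = defectC N φ (Φ.flow s z) x := fun _ _ _ _ _ _ _ => rfl

/-- Hence `X = ∫₀ᵗ anis(Φ_s z) ds` (definitional). -/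
theorem xint_eq : ∀ (σ : ℝ) (N : ℕ) (Φ : Flow σ N) (φ : ℕ → T3 → ℝ) (t : ℝ) (z : Cfg N),
    Xint σ N Φ φ t z = ∫ s in Icc 0 t, anisC N φ (Φ.flow s z) := fun _ _ _ _ _ _ => rfl


end

end Summit.AtomisticToContinuum.HydrodynamicLimit.Theorems.ContactBalance
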